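import Mathlib
import Summits.Ventures.HodgeRepro2.BridgeProjector

/-!
# BridgeCoprime — the projector onto a stable subspace as a polynomial in one operator (Tier 4, T4-A)

Seat p4 of the blind cell pub-hodge-repro2 (README §6, T4-A). PLAN.md §6.3 (b)(2) states that the
projector `p_W` onto the split Weil line is a polynomial with ℚ-coefficients in the pull-backs `[x]^*`
of `𝐅`-endomorphisms («eigenvalue separation + Lagrange interpolation; Galois-invariance of the
coefficients»). `BridgeProjector` handles the case of rational eigenvalues. This file proves the
general statement needed when the eigenvalues `σ(x)^4` are NOT rational, in Bézout form, with no
field extension: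

Let `T` be an endomorphism of a finite-dimensional `K`-space `V`, `W ≤ V` a `T`-stable subspace,
`p, q ∈ K[X]` with `p(T) = 0` on `W` and `q(T) V ⊆ W`, and `a p + b q = 1` (Bézout; exists iff
`IsCoprime p q`). Then `e := (b q)(T)` is a `K`-polynomial in `T` which is the identity on `W`, maps
`V` into `W` (`proj_apply_mem`), is idempotent, and maps every `T`-stable subspace `A` into `A ⊓ W`
(`proj_apply_mem_inf`): the `W`-component of an algebraic class is algebraic as soon as `T` preserves
algebraic classes. For `q` one may always take the characteristic polynomial of `T` on `V ⧸ W`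
(Cayley–Hamilton: `aeval_charpoly_quotMap_mem`), and for `p` the minimal polynomial of `T|_W` — both
in `K[X]` by construction, so «Galois-invariance of the coefficients» is automatic; what remains for
the prose is the COPRIMALITY `IsCoprime p q`, i.e. that no eigenvalue of `T` on `W` is an eigenvalue
of `T` on `V ⧸ W` (eigenvalue separation).
-/

namespace Summit.Ventures.HodgeRepro2.BridgeCoprime

open Polynomial Summit.Ventures.HodgeRepro2.BridgeProjector

variable {K : Type*} [Field K] {V : Type*} [AddCommGroup V] [Module K V]

section Quotient

variable (T : Module.End K V) (W : Submodule K V) (hW : W ≤ W.comap T)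

/-- The endomorphism induced by `T` on `V ⧸ W` (for `W` `T`-stable). -/
noncomputable def quotMap : Module.End K (V ⧸ W) := W.mapQ W T hW

/-- `T ^ n` descends to `(quotMap T W hW) ^ n` on the quotient. -/
theorem mkQ_pow_apply (n : ℕ) (v : V) :
    W.mkQ ((T ^ n) v) = ((quotMap T W hW) ^ n) (W.mkQ v) := by
  rw [quotMap, ← Submodule.mapQ_pow W hW n, Submodule.mkQ_apply, Submodule.mkQ_apply,
    Submodule.mapQ_apply]

/-- Every polynomial in `T` descends to the same polynomial in `quotMap T W hW`. -/
theorem mkQ_aeval_apply (p : K[X]) (v : V) :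
    W.mkQ ((aeval T p) v) = (aeval (quotMap T W hW) p) (W.mkQ v) := by
  induction p using Polynomial.induction_on' with
  | add p q hp hq => rw [map_add, LinearMap.add_apply, map_add, hp, hq, map_add, LinearMap.add_apply]
  | monomial n a =>
    rw [aeval_monomial, aeval_monomial, Module.End.mul_apply, Module.End.mul_apply,
      Module.algebraMap_end_apply, Module.algebraMap_end_apply, map_smul, mkQ_pow_apply]

/-- **Cayley–Hamilton on the quotient**: the characteristic polynomial of `T` on `V ⧸ W`, evaluated
at `T`, maps `V` into `W`. -/
theorem aeval_charpoly_quotMap_mem [FiniteDimensional K V] (v : V) :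
    (aeval T (quotMap T W hW).charpoly) v ∈ W := by
  rw [← Submodule.Quotient.mk_eq_zero, ← Submodule.mkQ_apply, mkQ_aeval_apply T W hW,
    LinearMap.aeval_self_charpoly, LinearMap.zero_apply]

end Quotient

section Projector

variable (T : Module.End K V) {W : Submodule K V}

/-- The Bézout projector: `e := (b q)(T)`. -/
noncomputable def proj (b q : K[X]) : Module.End K V := aeval T (b * q)

/-- `e` maps `V` into `W` when `q(T) V ⊆ W` and `W` is `T`-stable. -/
theorem proj_apply_mem (hW : ∀ v ∈ W, T v ∈ W) {q : K[X]} (hq : ∀ v, (aeval T q) v ∈ W)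
    (b : K[X]) (v : V) : proj T b q v ∈ W := by
  rw [proj, map_mul, Module.End.mul_apply]
  exact aeval_apply_mem_of_stable W hW b (hq v)

/-- `e` is the identity on `W` when `p(T)` kills `W` and `a p + b q = 1`. -/
theorem proj_apply_of_mem {p q a b : K[X]} (hab : a * p + b * q = 1)
    (hp : ∀ w ∈ W, (aeval T p) w = 0) {w : V} (hw : w ∈ W) : proj T b q w = w := by
  have h1 : (aeval T (a * p + b * q)) w = w := by rw [hab, map_one, Module.End.one_apply]
  rw [map_add, LinearMap.add_apply, map_mul, Module.End.mul_apply, hp w hw, map_zero, zero_add]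
    at h1
  exact h1

/-- `e` is idempotent. -/
theorem proj_proj (hW : ∀ v ∈ W, T v ∈ W) {p q a b : K[X]} (hab : a * p + b * q = 1)
    (hp : ∀ w ∈ W, (aeval T p) w = 0) (hq : ∀ v, (aeval T q) v ∈ W) (v : V) :
    proj T b q (proj T b q v) = proj T b q v :=
  proj_apply_of_mem T hab hp (proj_apply_mem T hW hq b v)

/-- **The point.** If `A` is `T`-stable (algebraic classes are stable under the correspondence `T`),
then the Bézout projector maps `A` into `A ⊓ W`: the `W`-component of an algebraic class is
algebraic. -/
theorem proj_apply_mem_inf (hW : ∀ v ∈ W, T v ∈ W) {q : K[X]} (hq : ∀ v, (aeval T q) v ∈ W)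
    (b : K[X]) (A : Submodule K V) (hA : ∀ v ∈ A, T v ∈ A) {v : V} (hv : v ∈ A) :
    proj T b q v ∈ A ⊓ W :=
  ⟨aeval_apply_mem_of_stable A hA _ hv, proj_apply_mem T hW hq b v⟩

/-- **Packaged with Cayley–Hamilton**: if `W` is `T`-stable, `p(T)` kills `W`, and `p` is coprime to
the characteristic polynomial `q` of `T` on `V ⧸ W`, then there is a polynomial `r ∈ K[X]` such that
`r(T)` is the identity on `W`, maps `V` into `W`, and maps every `T`-stable `A` into `A ⊓ W`. -/
theorem exists_aeval_proj [FiniteDimensional K V] (hW : W ≤ W.comap T) {p : K[X]}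
    (hp : ∀ w ∈ W, (aeval T p) w = 0) (hpq : IsCoprime p (quotMap T W hW).charpoly) :
    ∃ r : K[X], (∀ w ∈ W, (aeval T r) w = w) ∧ (∀ v, (aeval T r) v ∈ W) ∧
      ∀ A : Submodule K V, (∀ v ∈ A, T v ∈ A) → ∀ v ∈ A, (aeval T r) v ∈ A ⊓ W := by
  obtain ⟨a, b, hab⟩ := hpq
  have hW' : ∀ v ∈ W, T v ∈ W := fun v hv => hW hv
  have hq : ∀ v, (aeval T (quotMap T W hW).charpoly) v ∈ W :=
    aeval_charpoly_quotMap_mem T W hW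
  refine ⟨b * (quotMap T W hW).charpoly, fun w hw => ?_, fun v => ?_, fun A hA v hv => ?_⟩
  · exact proj_apply_of_mem T hab hp hw
  · exact proj_apply_mem T hW' hq b v
  · exact proj_apply_mem_inf T hW' hq b A hA hv

end Projector

end Summit.Ventures.HodgeRepro2.BridgeCoprime
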